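import Summits.CriticalPhenomena.CardyFormulaZ2.Theorems.CardySelfDualSegmentUniformMarginalityDefs

/-!
# Stub (C) `stub_pextContinuous` of line `Sketch` for the crux `UniformMarginality`
(stmt-CriticalPhenomena-5472): for `δ > 0`, `s ↦ Pext R δ s` is continuous.

Proof route: `Pext_eq_sum` (cylinder polynomial in `projIcc 0 1 s`), continuity of finite sums
and products (`continuous_finsetSum` / `continuous_finsetProd`, the `if`s being constant in `s`),
and continuity of each coordinate `s ↦ (cornerParam (projIcc 0 1 s) i : ℝ)` (the constant `1/2`
on coins, `1/2 · projIcc 0 1 s` on splitting bits; `continuous_projIcc`).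
-/

namespace Summit.CriticalPhenomena.CardyFormulaZ2.Cruxes.UniformMarginality.HeatFlow

open MeasureTheory Literature.Probability.Percolation Literature.Probability.LatticeModels
  Literature.Probability.RandomPlanarGeometry

/-- Each coordinate `s ↦ (cornerParam (projIcc 0 1 s) i : ℝ)` is continuous: it is the constant
`1/2` on a coin (`i.2 = 0`) and `s ↦ 1/2 · projIcc 0 1 s` on a splitting bit (`i.2 = 1`). -/
private theorem continuous_coe_cornerParam_projIcc (i : Site 2 × Fin 2) :
    Continuous fun s : ℝ =>
      ((cornerParam (Set.projIcc (0 : ℝ) 1 zero_le_one s) i : unitInterval) : ℝ) := by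
  have hp : Continuous (Set.projIcc (0 : ℝ) 1 zero_le_one) := continuous_projIcc
  unfold cornerParam
  by_cases hi : i.2 = 0
  · simp only [if_pos hi]
    exact continuous_const
  · simp only [if_neg hi, Set.Icc.coe_mul]
    exact continuous_const.mul hp.subtype_val

/-- STUB (C) of line `Sketch`: for `δ > 0` the extended crossing probability `s ↦ Pext R δ s`
is continuous (it is a cylinder polynomial in `projIcc 0 1 s`). -/
theorem stub_pextContinuous : PextContinuous := by
  intro R δ hδ
  rw [show Pext R δ = _ from funext (Pext_eq_sum R hδ)]
  refine continuous_finsetSum _ fun T _ => ?_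
  by_cases hT : (↑T : Set (Site 2 × Fin 2)) ∈ coinEvent R δ
  · simp only [if_pos hT]
    refine continuous_finsetProd _ fun i _ => ?_
    by_cases hi : i ∈ T
    · simp only [if_pos hi]
      exact continuous_coe_cornerParam_projIcc i
    · simp only [if_neg hi]
      exact continuous_const.sub (continuous_coe_cornerParam_projIcc i)
  · simp only [if_neg hT]
    exact continuous_const

end Summit.CriticalPhenomena.CardyFormulaZ2.Cruxes.UniformMarginality.HeatFlow
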